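import Mathlib
import HarnessLib
import Summits.NavierStokesRegularity.NavierStokesRegularity.Theorems.HalfSpaceWindowDoorCirculationCarryingRigidityConeSupportRigidity
import Summits.NavierStokesRegularity.NavierStokesRegularity.Theorems.AxisTwistDoorAveragedConeLiouvilleFlatFlux
import Summits.NavierStokesRegularity.NavierStokesRegularity.Theorems.AxisTwistDoorAveragedConeLiouvilleCircleCalculus

/-!
# Route `HalfSpaceWindowDoor`, crux `CirculationCarryingRigidity` (stmt-NavierStokesRegularity-25311) —
# line `cone_sweep`, FAR-FIELD form, Step 3: support rigidity under the circle cone on FAR circles about one axis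

LEAD ns-hsw-p1 g9, `--supports stmt-NavierStokesRegularity-25311 --as helper`; card `Cruxes/…/Lines/cone_sweep.md`.  Generalisation of
`…ConeSupportRigidity` (p682589): the cone-line monotonicity of `Γ` and the saturated-disc rigidity need the CIRCLE-AVERAGED cone
`∮|ω_h| dl ≤ K∮ω₃ dl` only on the circles about the `e₃`-axis of radius `≥ ρ₀` on the slice in question (`circ_farConeLine_mono`,
`eq_zero_of_saturated_far` with the saturating radius `R ≥ ρ₀`): `Γ` is non-decreasing along `h ↦ (R + Kh, z₀ ± h)`, a slice whose circulation
is saturated by the disc `D(R,z₀)` has `Γ(·,z,s₀) ≡ S` beyond `R + K|z − z₀|`, `curl = 0` on an open set, and `v ≡ 0`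
(`eq_zero_of_curl_eq_zero_on_open`).  Consumed by `…FarConeLiouville`.
WHAT THIS IS NOT: not about NS regularity; HYPOTHETICAL profiles.  No item is closed by this file.
-/

noncomputable section

-- the summit and its single sub-problem share the name (CONVENTIONS §1), as in every Theorems file
set_option linter.dupNamespace false

namespace Summit.NavierStokesRegularity.NavierStokesRegularity.Theorems.HalfSpaceWindowDoorCirculationCarryingRigidityFarConeRigidity

open MeasureTheory Set Function Filter Topology InnerProductSpace
open scoped RealInnerProductSpace InnerProductSpace
open Literature.Analysis Literature.Analysis.FluidPDE Literature.Analysis.UnboundedOperators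
open Summit.NavierStokesRegularity.NavierStokesRegularity.Theses.HalfSpaceWindowDoor
open Summit.NavierStokesRegularity.NavierStokesRegularity.Theorems.HalfSpaceWindowDoorCirculationCarryingRigidityDefs
  (InDoorClass SignE3 e3)
open Summit.NavierStokesRegularity.NavierStokesRegularity.Theorems.AxisTwistDoorAveragedConeLiouvilleDefs
  (cylPt eT eR circ vortCirc radVortCirc tiltCirc)
open Summit.NavierStokesRegularity.NavierStokesRegularity.Theorems.AveragedConeLiouville.CircleStokes
  (hasDerivAt_circ deriv_circ_eq_vortCirc inner_e3)
open Summit.NavierStokesRegularity.NavierStokesRegularity.Theorems.AveragedConeLiouville.CircleCalculus (hasDerivAt_circ_z)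
open Summit.NavierStokesRegularity.NavierStokesRegularity.Theorems.AveragedConeLiouville.CircMonotone
  (circ_zero circ_mono circ_nonneg vortCirc_nonneg)
open Summit.NavierStokesRegularity.NavierStokesRegularity.Theorems.AveragedConeLiouville.FlatFlux
  (eq_zero_of_integral_eq_zero_of_nonneg exists_cylPt_eq)
open Summit.NavierStokesRegularity.NavierStokesRegularity.Theorems.AxisTwistDoorAveragedConeLiouvilleCylFrame
  (continuous_cylPt_θ continuous_horizontal abs_inner_eR_le_norm_horizontal)
open Summit.NavierStokesRegularity.NavierStokesRegularity.Theorems.HalfSpaceWindowDoorCirculationCarryingRigidityAxisCirculation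
  (contDiffOn_circ isSmoothSpaceTimeOn_of_class)
open Summit.NavierStokesRegularity.NavierStokesRegularity.Theorems.PoloidalWindowDoorPoloidalWindowRigiditySymmetryGerms
  (eq_zero_of_curl_eq_zero_on_open)
open Summit.NavierStokesRegularity.NavierStokesRegularity.Theorems.HalfSpaceWindowDoorCirculationCarryingRigidityConeFluxSubsolution
  (signE3_atd contDiff_one_slice)
open Summit.NavierStokesRegularity.NavierStokesRegularity.Theorems.HalfSpaceWindowDoorCirculationCarryingRigidityConeSupportRigidity
  (abs_radVortCirc_le hasDerivAt_circ_line curl_eq_zero_on_circle_of_const)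

variable {C : ℝ} {v : ℝ → EuclideanSpace ℝ (Fin 3) → EuclideanSpace ℝ (Fin 3)}

/-! ### Monotonicity of `Γ` along the cone lines, far-field form -/

/-- **`Γ` is non-decreasing along the cone lines `h ↦ (R + Kh, z₀ ± h)`, `h ≥ 0`, `R ≥ ρ₀`**, given the circle cone on the circles of radius
`≥ ρ₀` of the slice. -/
theorem circ_farConeLine_mono (hv : InDoorClass C v) {K : ℝ} (hK : 0 ≤ K) {s : ℝ} (hs : s < 0) {ρ₀ : ℝ} (hρ₀ : 0 ≤ ρ₀)
    (hcone : ∀ r : ℝ, ρ₀ ≤ r → ∀ z : ℝ, tiltCirc v r z s ≤ K * vortCirc v r z s)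
    {R : ℝ} (hR : ρ₀ ≤ R) (z₀ : ℝ) {ε : ℝ} (hε : ε = 1 ∨ ε = -1) :
    MonotoneOn (fun h => circ v (R + K * h) (z₀ + ε * h) s) (Ici 0) := by
  have hv1 := contDiff_one_slice hv hs
  have hd := fun h => hasDerivAt_circ_line hv hs R K z₀ ε h
  refine monotoneOn_of_deriv_nonneg (convex_Ici 0) ?_ ?_ fun h hh => ?_
  · exact (continuous_iff_continuousAt.2 fun h => (hd h).continuousAt).continuousOn
  · intro h _; exact (hd h).differentiableAt.differentiableWithinAt
  · rw [interior_Ici] at hh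
    rw [(hd h).deriv]
    have hh' := le_of_lt (mem_Ioi.1 hh)
    have hrρ : ρ₀ ≤ R + K * h := hR.trans (by nlinarith)
    have hr0 : 0 ≤ R + K * h := hρ₀.trans hrρ
    have h1 := abs_radVortCirc_le hv1 hr0 (z₀ + ε * h)
    have h2 := hcone _ hrρ (z₀ + ε * h)
    have h3 := (abs_le.1 (h1.trans h2))
    rcases hε with e | e <;> subst e <;> nlinarith [h3.1, h3.2]

/-! ### Saturated circulation ⇒ the profile vanishes -/

/-- **SUPPORT RIGIDITY, far-field form.**  A closed-hemisphere door-class profile with the circle cone on the circles of radius `≥ ρ₀`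
of ONE slice `s₀`, whose circulation on that slice is SATURATED by a disc `D(R, z₀)` with `R ≥ ρ₀`, vanishes identically. -/
theorem eq_zero_of_saturated_far (hv : InDoorClass C v) (hsign : SignE3 v) {K : ℝ} (hK : 0 ≤ K)
    {s₀ : ℝ} (hs₀ : s₀ < 0) {ρ₀ : ℝ} (hρ₀ : 0 ≤ ρ₀) (hcone : ∀ r : ℝ, ρ₀ ≤ r → ∀ z : ℝ, tiltCirc v r z s₀ ≤ K * vortCirc v r z s₀)
    {R z₀ S : ℝ} (hR : ρ₀ ≤ R) (hsat : circ v R z₀ s₀ = S) (hle : ∀ r : ℝ, 0 ≤ r → ∀ z : ℝ, circ v r z s₀ ≤ S) :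
    ∀ t < 0, ∀ x, v t x = 0 := by
  have hR0 : 0 ≤ R := hρ₀.trans hR
  have hv1 := contDiff_one_slice hv hs₀
  have hsign' : ∀ y, 0 ≤ ⟪curl (v s₀) y,
      Summit.NavierStokesRegularity.NavierStokesRegularity.Theorems.AxisTwistDoorAveragedConeLiouvilleDefs.e3⟫ :=
    fun y => signE3_atd hsign s₀ hs₀ y
  -- along the cone lines the disc stays saturated: `Γ(R + K|z − z₀|, z, s₀) = S`
  have hline : ∀ z : ℝ, circ v (R + K * |z - z₀|) z s₀ = S := by
    intro z
    refine le_antisymm (hle _ (by positivity) z) ?_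
    rcases le_or_gt z₀ z with hz | hz
    · have h := circ_farConeLine_mono hv hK hs₀ hρ₀ hcone hR z₀ (ε := 1) (Or.inl rfl) (self_mem_Ici)
        (mem_Ici.2 (sub_nonneg.2 hz)) (sub_nonneg.2 hz)
      have e1 : circ v (R + K * 0) (z₀ + 1 * 0) s₀ = S := by rw [mul_zero, add_zero, mul_zero, add_zero, hsat]
      have e2 : circ v (R + K * (z - z₀)) (z₀ + 1 * (z - z₀)) s₀ = circ v (R + K * |z - z₀|) z s₀ := by
        rw [abs_of_nonneg (sub_nonneg.2 hz), one_mul, add_sub_cancel]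
      have h' : circ v (R + K * 0) (z₀ + 1 * 0) s₀ ≤ circ v (R + K * (z - z₀)) (z₀ + 1 * (z - z₀)) s₀ := h
      rw [e1, e2] at h'
      exact h'
    · have h := circ_farConeLine_mono hv hK hs₀ hρ₀ hcone hR z₀ (ε := -1) (Or.inr rfl) (self_mem_Ici)
        (mem_Ici.2 (sub_nonneg.2 hz.le)) (sub_nonneg.2 hz.le)
      have e1 : circ v (R + K * 0) (z₀ + -1 * 0) s₀ = S := by rw [mul_zero, add_zero, mul_zero, add_zero, hsat]
      have e2 : circ v (R + K * (z₀ - z)) (z₀ + -1 * (z₀ - z)) s₀ = circ v (R + K * |z - z₀|) z s₀ := by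
        rw [abs_of_neg (sub_neg.2 hz), neg_sub, show z₀ + -1 * (z₀ - z) = z by ring]
      have h' : circ v (R + K * 0) (z₀ + -1 * 0) s₀ ≤ circ v (R + K * (z₀ - z)) (z₀ + -1 * (z₀ - z)) s₀ := h
      rw [e1, e2] at h'
      exact h'
  -- beyond the cone line `Γ(·, z, s₀) ≡ S`
  have hconst : ∀ z r : ℝ, R + K * |z - z₀| ≤ r → circ v r z s₀ = S := fun z r hr =>
    le_antisymm (hle r ((by positivity : (0:ℝ) ≤ R + K * |z - z₀|).trans hr) z)
      ((hline z).symm.le.trans (circ_mono v hv1 (signE3_atd hsign) hs₀ (by positivity) hr z))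
  -- the open vorticity-free region `{y₁ > 0, (R + K|y₂ − z₀| + 1)² < y₀² + y₁²}`
  set U : Set (EuclideanSpace ℝ (Fin 3)) := {y | 0 < y 1 ∧ (R + K * |y 2 - z₀| + 1) ^ 2 < y 0 ^ 2 + y 1 ^ 2} with hU
  have hcont_yi : ∀ i : Fin 3, Continuous fun y : EuclideanSpace ℝ (Fin 3) => y i := fun i =>
    (continuous_apply i).comp (PiLp.continuous_ofLp 2 _)
  have hUo : IsOpen U := by
    refine (isOpen_lt continuous_const (hcont_yi 1)).inter (isOpen_lt ?_ (((hcont_yi 0).pow 2).add ((hcont_yi 1).pow 2)))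
    exact ((continuous_const.add (continuous_const.mul (((hcont_yi 2).sub continuous_const).abs))).add continuous_const).pow 2
  have hUne : U.Nonempty := by
    refine ⟨cylPt (R + 2) (Real.pi / 2) z₀, ?_, ?_⟩
    · show 0 < (cylPt (R + 2) (Real.pi / 2) z₀) 1
      simp [cylPt]; linarith
    · show (R + K * |(cylPt (R + 2) (Real.pi / 2) z₀) 2 - z₀| + 1) ^ 2 <
        (cylPt (R + 2) (Real.pi / 2) z₀) 0 ^ 2 + (cylPt (R + 2) (Real.pi / 2) z₀) 1 ^ 2
      simp [cylPt]; nlinarith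
  refine eq_zero_of_curl_eq_zero_on_open hv.1 hv.2.1 hv.2.2.1 hv.2.2.2 hs₀ hUo hUne fun y hy => ?_
  obtain ⟨hy1, hy2⟩ := hy
  obtain ⟨r, θ, hr, hr2, hθ, hyeq⟩ := exists_cylPt_eq hy1
  have hy2' : (R + K * |y 2 - z₀| + 1) ^ 2 < r ^ 2 := by rw [hr2]; exact hy2
  have hRr : R + K * |y 2 - z₀| + 1 < r := by
    have h0 : 0 ≤ R + K * |y 2 - z₀| + 1 := by positivity
    nlinarith
  rw [← hyeq]
  have hKa : 0 ≤ K * |y 2 - z₀| := by positivity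
  have hρr : ρ₀ ≤ r := by linarith
  refine curl_eq_zero_on_circle_of_const hv1 hsign' hr (hcone r hρr (y 2)) (c := S) ?_ hθ
  filter_upwards [Ioi_mem_nhds (show R + K * |y 2 - z₀| < r by linarith)] with r' hr'
  exact hconst (y 2) r' (le_of_lt hr')

end Summit.NavierStokesRegularity.NavierStokesRegularity.Theorems.HalfSpaceWindowDoorCirculationCarryingRigidityFarConeRigidity

end
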